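import Mathlib.LinearAlgebra.Matrix.ToLin
import Mathlib.Data.Matrix.Block
import Literature.NumberTheory.EllipticCurves.BSDSelmer
import Literature.NumberTheory.EllipticCurves.BSDSelmerSmithCases
import Literature.NumberTheory.EllipticCurves.SelmerPInftyIsogeny
import HarnessLib

/-!
# Smith 2025, §1.1: the distribution of `φ`-Selmer and `2`-Selmer ranks in the quadratic twist family of a curve with a balanced isogeny (Theorems 1.10, 1.12, 1.14)

A. Smith, *The Birch and Swinnerton-Dyer conjecture implies Goldfeld's conjecture*,
arXiv:2503.17619 (2025), abstract: *"As part of this work, we determine the distribution of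
`2`-Selmer ranks in the quadratic twist family of `E`. In the cases where this distribution was
not already known, it is distinct from the model for distributions of `2`-Selmer groups
constructed by Poonen and Rains."* The tree already holds §1's corank theorems (Thm. 1.1 =
`smith_selmerCorank_density`, Thm. 1.17 = `smith2025_thm117_caseIV/V`, Def. 1.6, Def. 1.16,
Prop. 1.18). This file vendors the three printed RANK-DISTRIBUTION theorems of §1.1 as named facts
(D-0014), with the vocabulary they need (Notation 1.8, 1.9, 1.13), all for models with
`a₁ = a₃ = 0` (`IsCharNeTwoNF`, Smith's `y² = x³ + ax + b`, as in the tree's other Smith files):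

* Notation 1.8: `selmerTorsionRank p W` = `r_p(E) = dim_{𝔽_p} Sel_{p^∞}(E/K)[p]` ("the maximal `r`
  so that `(ℤ/2ℤ)^r ↪ Sel^{2^∞} E`", `k = 1`); `selmerIsogenyRank p f hf` / `Isogeny.selmerRank` =
  `r_φ(E) = dim_{𝔽_2} im(H¹(G_ℚ, E[φ]) → H¹(G_ℚ, E[2^∞])) ∩ Sel^{2^∞} E`, written — exactly as the
  tree's `selmerDivRank` (Def. 1.16, `SelmerPInftyIsogeny.lean`) — with `ker φ_*` for the image
  (exactness of `H¹(E[φ]) → H¹(E[2^∞]) →(φ) H¹(E_0[2^∞])`, first line of Smith's proof of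
  Prop. 1.18); the twist functions `Isogeny.twistSelmerRank φ d = r_φ(E^d)`,
  `twistSelmerTorsionRank W d = r_2(E^d)`; the class `X_E(d_0, H)` as the predicate
  `smithTwistClass E d₀ d` ("squarefree `d` such that `d d_0 ∈ (ℚ_v^×)²` for `v = 2, ∞` and all
  places of bad reduction for `E`"; `|d| ≤ H` is put in the counting sets); the torsion condition
  "`E^d(ℚ)[2] = E^d(ℚ)[4]`" as `NoRationalFourTorsion`; and `u(φ, d_0) = r_φ(E^d) − r_{φ'}(E_0^d)`
  for such a `d ∈ X_E(d_0, H)` (Notation 1.8 verbatim: "this does not depend on the choice of `d`",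
  Def. 3.1 — so the statements below quantify over ANY admissible `d₁` and read `u` off it).
* Notation 1.9 / 1.13: `probKerDimMatrix m n j = P^Mat(j | m × n)`, `probKerDimAlt n j = P^Alt(j | n)`
  (alternating = `Mᵀ = −M` with zero diagonal), `probKerDimV j n k = P^V(j | n → 2k)` (pull back the
  standard nondegenerate alternating pairing on `𝔽_2^{2k}` along a uniformly random
  `T : 𝔽_2^n → 𝔽_2^{2k}`; all nondegenerate alternating pairings on `𝔽_2^m` are `GL_m`-conjugate
  and `T` is `GL_m`-invariant in law, so fixing one is Smith's "Fix a nondegenerate alternating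
  pairing `P_0`"). The LIMIT `P^Mat(j | (∞ − u) × ∞) = lim_n P^Mat(j | (n − u) × n)` is not given
  a junk-valued name: Theorem 1.10 is stated for "the limit `P` of `P^Mat(r | (n − u) × n)`"
  (hypothesis `Tendsto … (𝓝 P)`; the limit exists, with an explicit formula, [Smi22b]).
* `smith2025_thm110` (Thm. 1.10), `smith2025_thm112` (Thm. 1.12, Case IV),
  `smith2025_thm114` (Thm. 1.14, Case V; including "`u_0 = −u_1 − u_2` is a nonnegative even
  integer").

PUBLICATION STATUS: arXiv preprint (v1 2025-03; no journal version found 2026-08-26) — these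
are PREPRINT-grade named facts, like `smith2025_thm117_caseIV/V`.

## What is NOT here

Def. 3.1 (the Tamagawa ratio `𝒯(φ, d) = ∏_v #W_v(φ, d)/2`, `W_v = ker(H¹(G_v, E^d[φ]) → H¹(G_v, E^d))`,
and `u(φ, d) = log_2 𝒯(φ, d)`; (3.1) `u = dim Sel^φ(E^d) − dim Sel^{φ'}(E_0^d)` by Greenberg–Wiles)
— the tree has no local condition groups for isogeny kernels; Theorem 2.4 (grids of degree-`ℓ`
twists of a twistable `ℤ_ℓ[ξ][G_F]`-module); §§3–6. Remark 1.15's assembled all-`d` law for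
`r_2(E^d)` is not printed and not stated. Nothing is proved about the facts; the definitional API
is `rfl`-level only.

## References

* [SmithGoldfeld2025] A. Smith, arXiv:2503.17619 (2025): Notation 1.8, 1.9 (p. 4), Thm. 1.10,
  Rem. 1.11, Thm. 1.12, Notation 1.13, Thm. 1.14, Rem. 1.15 (pp. 4–5), Def. 3.1 (§3.1).
* [Smith2026SelmerTwistI] A. Smith, J. Amer. Math. Soc. 39 (2026), Def. 1.4 (`P^Alt(j | n)`:
  "the probability that a uniformly selected alternating `n × n` matrix with entries in `𝔽_2` has
  kernel of dimension exactly `j`").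
-/

noncomputable section

open scoped Classical
open scoped AddSubgroup
open Filter Topology

universe u

namespace Literature.NumberTheory.EllipticCurves

open WeierstrassCurve Literature.NumberTheory.GaloisRepresentations

/-! ## Notation 1.9 / 1.13: kernel laws of random matrices over `𝔽₂` -/

/-- **`P^Mat(j | m × n)`** (Smith, arXiv:2503.17619, Notation 1.9): the probability that a
uniformly random `m × n` matrix over `𝔽₂` — a linear map `𝔽₂ⁿ → 𝔽₂ᵐ`, `x ↦ Mx` — has kernel of
dimension `j`: `#{M : dim ker M = j} / 2^{mn}`. [cite: SmithGoldfeld2025, Notation 1.9] -/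
def probKerDimMatrix (m n j : ℕ) : ℝ :=
  (Nat.card {M : Matrix (Fin m) (Fin n) (ZMod 2) //
      Module.finrank (ZMod 2) (LinearMap.ker M.mulVecLin) = j} : ℝ) / 2 ^ (m * n)

/-- **`P^Alt(j | n)`** (Smith, arXiv:2503.17619, Notation 1.9; J. Amer. Math. Soc. 39 (2026),
Def. 1.4): the probability that a uniformly random ALTERNATING `n × n` matrix over `𝔽₂`
(`Mᵀ = −M` with zero diagonal, i.e. the Gram matrix of an alternating pairing on `𝔽₂ⁿ`) has
kernel of dimension `j`. [cite: SmithGoldfeld2025, Notation 1.9] -/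
def probKerDimAlt (n j : ℕ) : ℝ :=
  (Nat.card {M : Matrix (Fin n) (Fin n) (ZMod 2) //
      (M.transpose = -M ∧ ∀ i, M i i = 0) ∧
        Module.finrank (ZMod 2) (LinearMap.ker M.mulVecLin) = j} : ℝ) /
    Nat.card {M : Matrix (Fin n) (Fin n) (ZMod 2) // M.transpose = -M ∧ ∀ i, M i i = 0}

/-- The standard nondegenerate alternating pairing on `𝔽₂^{2k} = 𝔽₂ᵏ ⊕ 𝔽₂ᵏ`, as its Gram matrix
`J = [[0, 1], [−1, 0]]` (blocks of size `k`). Smith, arXiv:2503.17619, Notation 1.13 ("Fix a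
nondegenerate alternating pairing `P_0` on `𝔽_2^m`", `m` even). [cite: SmithGoldfeld2025, Notation 1.13] -/
def stdAltGram (k : ℕ) : Matrix (Fin k ⊕ Fin k) (Fin k ⊕ Fin k) (ZMod 2) :=
  Matrix.fromBlocks 0 1 (-1) 0

/-- **`P^V(j | n → m)`, `m = 2k`** (Smith, arXiv:2503.17619, Notation 1.13): for a uniformly random
linear map `T : 𝔽₂ⁿ → 𝔽₂^{2k}` (a `2k × n` matrix) pull back the fixed nondegenerate alternating
pairing `P_0` (`stdAltGram k`) to `P(v, w) = P_0(Tv, Tw)` on `𝔽₂ⁿ`, Gram matrix `Tᵀ J T`; the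
probability that `P` has kernel (radical `{v : P(v, ·) = 0} = ker (Tᵀ J T)`) of dimension exactly
`j`. (Any two nondegenerate alternating pairings on `𝔽₂^m` are `GL_m(𝔽₂)`-conjugate and the law
of `T` is `GL_m`-invariant, so the choice of `P_0` is immaterial, as in print.)
[cite: SmithGoldfeld2025, Notation 1.13] -/
def probKerDimV (j n k : ℕ) : ℝ :=
  (Nat.card {T : Matrix (Fin k ⊕ Fin k) (Fin n) (ZMod 2) //
      Module.finrank (ZMod 2)
        (LinearMap.ker (T.transpose * stdAltGram k * T).mulVecLin) = j} : ℝ) / 2 ^ (2 * k * n)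

/-! ## Notation 1.8: `r_p(E)`, `r_φ(E)` inside `Sel_{p^∞}(E/K) ⊆ H¹(K, E[p^∞])` -/

section Ranks

variable {K : Type u} [Field K] [NumberField K] {W W' : WeierstrassCurve K} (p : ℕ)

/-- **`r_p(E) = dim_{𝔽_p} Sel_{p^∞}(E/K)[p]`** (Smith, arXiv:2503.17619, Notation 1.8 with `k = 1`:
"the maximal `r` so that there is some injection `(ℤ/2ℤ)^r ↪ Sel^{2^∞} E ⊂ H¹(G_ℚ, E[2^∞])`" —
such an injection lands in the `2`-torsion, an `𝔽₂`-vector space, finite-dimensional since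
`Sel_{p^∞}` is cofinitely generated). NOT the dimension of the classical `p`-Selmer group
`Sel^{(p)}(E) ⊆ H¹(K, E[p])`, which exceeds it by `dim E(K)[p]` in general.
[cite: SmithGoldfeld2025, Notation 1.8] -/
def selmerTorsionRank [Fact p.Prime] (W : WeierstrassCurve K) : ℕ :=
  letI : Module (ZMod p) ((↥(selmerGroupPInfty W p))[(p : ℤ)]) := AddSubgroup.torsionBy.zmodModule
  Module.finrank (ZMod p) ((↥(selmerGroupPInfty W p))[(p : ℤ)])

/-- **`r_φ(E)`** (Smith, arXiv:2503.17619, Notation 1.8: for a degree-`2` `ℚ`-isogeny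
`φ : E → E_0`, `r_φ(E^d) = dim_{𝔽_2} im(H¹(G_ℚ, E[φ]) → H¹(G_ℚ, E^d[2^∞])) ∩ Sel^{2^∞} E^d`), for a
`Γ_K`-equivariant `f : E(K̄) →+ E'(K̄)` and a prime `p`: the `𝔽_p`-dimension of the `p`-torsion of
`Sel_{p^∞}(E/K) ∩ ker (φ_* : H¹(K, E[p^∞]) → H¹(K, E'[p^∞]))` — the same rendering as the tree's
`selmerDivRank` (Def. 1.16) with `Sel` in place of `Sel_div`: `ker φ_* = im (H¹(K, E[φ]) → H¹(K, E[p^∞]))`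
by exactness, and for `deg φ = p` this group is killed by `p`. [cite: SmithGoldfeld2025, Notation 1.8] -/
def selmerIsogenyRank [Fact p.Prime] (f : W.geomPoints →+ W'.geomPoints)
    (hf : ∀ (σ : Field.absoluteGaloisGroup K) (P : W.geomPoints), f (σ • P) = σ • f P) : ℕ :=
  letI : Module (ZMod p) ((↥(selmerGroupPInfty W p ⊓ (galH1PrimaryMap p f hf).ker))[(p : ℤ)]) :=
    AddSubgroup.torsionBy.zmodModule
  Module.finrank (ZMod p) ((↥(selmerGroupPInfty W p ⊓ (galH1PrimaryMap p f hf).ker))[(p : ℤ)])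

end Ranks

/-- **"`E(ℚ)[2] = E(ℚ)[4]`"** (Smith, arXiv:2503.17619, Notation 1.8): `E` has no rational point
of exact order `4` — every `Γ_ℚ`-fixed geometric `4`-torsion point is `2`-torsion (rational
points = `Γ_ℚ`-fixed points of `E(ℚ̄)`, Silverman *AEC* VIII.§1, as in the tree's
`ratTwoTorsionCard`). [cite: SmithGoldfeld2025, Notation 1.8] -/
def NoRationalFourTorsion (W : WeierstrassCurve ℚ) : Prop :=
  ∀ P : W.geomPoints, (4 : ℤ) • P = 0 →
    (∀ σ : Field.absoluteGaloisGroup ℚ, σ • P = P) → (2 : ℤ) • P = 0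

/-- **The class `X_E(d_0, H)`** (Smith, arXiv:2503.17619, Notation 1.8), as a predicate on `d`
(the bound `|d| ≤ H` is imposed in the counting sets): "the set of squarefree integers `d` … such
that `d d_0` lies in `(ℚ_v^×)²` for `v` equal to `2`, `∞`, and all places of bad reduction for
`E`" — `d` squarefree, `d d_0 > 0`, `d d_0` a square in `ℚ_2`, and a square in `ℚ_p` at every prime
`p` of bad reduction of `E` (`¬ HasGoodReductionAtPrime`, model-independent); `d d_0 ≠ 0` so
"square" = "in `(ℚ_v^×)²`". [cite: SmithGoldfeld2025, Notation 1.8] -/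
def smithTwistClass (W : WeierstrassCurve ℚ) (d₀ d : ℤ) : Prop :=
  Squarefree d ∧ 0 < d₀ * d ∧ IsSquare (((d₀ * d : ℤ) : ℚ_[2])) ∧
    ∀ (p : ℕ) [Fact p.Prime], ¬ W.HasGoodReductionAtPrime p → IsSquare (((d₀ * d : ℤ) : ℚ_[p]))

/-- **`r_2(E^d)`** as a function of `d ∈ ℤ` (Smith, arXiv:2503.17619, Notation 1.8): the
`2`-Selmer rank `dim_{𝔽_2} Sel^{2^∞}(E^d)[2]` of the twist `E^d = W.quadraticTwist d` (junk at
`d = 0`, where the twist is singular; excluded by every statement). [cite: SmithGoldfeld2025, Notation 1.8] -/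
def twistSelmerTorsionRank (W : WeierstrassCurve ℚ) (d : ℤ) : ℕ :=
  selmerTorsionRank 2 (W.quadraticTwist (d : ℚ))

end Literature.NumberTheory.EllipticCurves

namespace WeierstrassCurve.Isogeny

open Literature.NumberTheory.EllipticCurves

variable {K : Type u} [Field K] {W W' : WeierstrassCurve K}

/-- `r_φ(E)` for an isogeny `φ` over a number field and a prime `p`
(`Literature.NumberTheory.EllipticCurves.selmerIsogenyRank` for `φ.toAddMonoidHom`; deliberate
dot-notation extension of the tree's `WeierstrassCurve.Isogeny`, as `Isogeny.divRank`).
[cite: SmithGoldfeld2025, Notation 1.8] -/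
abbrev selmerRank [NumberField K] (φ : Isogeny W W') (p : ℕ) [Fact p.Prime] : ℕ :=
  selmerIsogenyRank p φ.toAddMonoidHom φ.equivariant

/-- **Smith's `r_φ(E^d)`** as a function of `d ∈ ℤ` (arXiv:2503.17619, Notation 1.8: "there is an
associated isogeny from `E^d` to `E_0^d` that we also denote by `φ`"): for a `ℚ`-isogeny
`φ : E → E_0` between models with `a₁ = a₃ = 0` and `d ≠ 0`, `r_{φ^d}(E^d)` for the twisted isogeny
`φ^d : E^d → E_0^d` (`Isogeny.quadraticTwist`) at `p = 2`; junk value `0` at `d = 0`. Same shape as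
the tree's `Isogeny.twistDivRank`. [cite: SmithGoldfeld2025, Notation 1.8] -/
def twistSelmerRank {W W₀ : WeierstrassCurve ℚ} [W.IsCharNeTwoNF] [W₀.IsCharNeTwoNF]
    (φ : Isogeny W W₀) (d : ℤ) : ℕ :=
  if hd : (d : ℚ) ≠ 0 then (φ.quadraticTwist hd).selmerRank 2 else 0

/-- Unfolding `twistSelmerRank` at `d ≠ 0`: `r_φ(E^d)` is the rank of the twisted isogeny
`φ^d : E^d → E_0^d`. [cite: SmithGoldfeld2025, Notation 1.8] -/
theorem twistSelmerRank_of_ne_zero {W W₀ : WeierstrassCurve ℚ} [W.IsCharNeTwoNF]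
    [W₀.IsCharNeTwoNF] (φ : Isogeny W W₀) {d : ℤ} (hd : (d : ℚ) ≠ 0) :
    φ.twistSelmerRank d = (φ.quadraticTwist hd).selmerRank 2 := by
  rw [twistSelmerRank, dif_pos hd]

end WeierstrassCurve.Isogeny

namespace Literature.NumberTheory.EllipticCurves

open WeierstrassCurve

/-! ## The three printed laws -/

/-- **Smith, arXiv:2503.17619, Theorem 1.10 (distribution of `φ`-Selmer ranks for a balanced
isogeny).** "Choose a balanced isogeny `φ : E → E_0` and a nonzero integer `d_0`, and take
`u = u(φ, d_0)`. Then, for any `r ≥ 0`,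
`lim_{H → ∞} #{d ∈ X_E(d_0, H) : r_φ(E^d) = r} / #X_E(d_0, H) = P^Mat(r | (∞ − u) × ∞)`."
Transcription: `E, E_0` elliptic, models with `a₁ = a₃ = 0`; `φ` balanced (`Isogeny.IsBalanced`,
Def. 1.6); `φ'` its dual (`φ' ∘ φ = [2]`); `u = u(φ, d_0) := r_φ(E^{d₁}) − r_{φ'}(E_0^{d₁})` read
off ANY `d₁ ∈ X_E(d_0, ·)` with `E^{d₁}(ℚ)[2] = E^{d₁}(ℚ)[4]`, `E_0^{d₁}(ℚ)[2] = E_0^{d₁}(ℚ)[4]`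
(Notation 1.8: such `d₁` exist and `u` "does not depend on the choice"); the right-hand side is
the limit `P` of `P^Mat(r | (n − u) × n)` as `n → ∞` (Notation 1.9; hypothesis `hP`), and the
density is taken along `H ∈ ℕ`. PREPRINT (arXiv only). [cite: SmithGoldfeld2025, Thm. 1.10 with Notation 1.8, 1.9] -/
def smith2025_thm110 : Prop :=
  ∀ (E E₀ : WeierstrassCurve ℚ) [E.IsElliptic] [E₀.IsElliptic] [E.IsCharNeTwoNF] [E₀.IsCharNeTwoNF]
    (φ : Isogeny E E₀) (φ' : Isogeny E₀ E), φ.IsBalanced → (∀ P, φ' (φ P) = (2 : ℤ) • P) →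
    ∀ (d₀ d₁ : ℤ), d₀ ≠ 0 → smithTwistClass E d₀ d₁ →
      NoRationalFourTorsion (E.quadraticTwist (d₁ : ℚ)) →
      NoRationalFourTorsion (E₀.quadraticTwist (d₁ : ℚ)) →
    ∀ (r : ℕ) (P : ℝ),
      Tendsto (fun n : ℕ ↦ probKerDimMatrix
        (((n : ℤ) - ((φ.twistSelmerRank d₁ : ℤ) - φ'.twistSelmerRank d₁)).toNat) n r) atTop (𝓝 P) →
      Tendsto (fun H : ℕ ↦
        (Nat.card {d : ℤ | smithTwistClass E d₀ d ∧ |d| ≤ (H : ℤ) ∧ φ.twistSelmerRank d = r} : ℝ) /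
          Nat.card {d : ℤ | smithTwistClass E d₀ d ∧ |d| ≤ (H : ℤ)}) atTop (𝓝 P)

/-- **Smith, arXiv:2503.17619, Theorem 1.12 (`2`-Selmer ranks, Case IV).** "Take `E/ℚ` to be a
curve in Case IV, and take `φ : E → E_0` to be its unique balanced isogeny. Choose a nonzero
integer `d_0`, and take `u = u(φ, d_0)`. Then, given any integers `r_2 ≥ r_φ ≥ max(u, 0)`, we have
`lim_{H → ∞} #{d ∈ X_E(d_0, H) : r_φ(E^d) = r_φ and r_2(E^d) = r_2} / #{d ∈ X_E(d_0, H) : r_φ(E^d) = r_φ}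
 = P^Alt(r_2 − r_φ | r_φ − u)`." Transcription as in `smith2025_thm110` (Case IV =
`smithCaseIV`; `φ` balanced with dual `φ'`; `u` read off an admissible `d₁`; `r_2(E^d)` =
`twistSelmerTorsionRank E d` = `dim_{𝔽_2} Sel^{2^∞}(E^d)[2]`, Notation 1.8; `P^Alt` = `probKerDimAlt`,
argument `r_φ − u ≥ 0` as a natural number). PREPRINT (arXiv only).
[cite: SmithGoldfeld2025, Thm. 1.12 with Notation 1.8, 1.9] -/
def smith2025_thm112 : Prop :=
  ∀ (E E₀ : WeierstrassCurve ℚ) [E.IsElliptic] [E₀.IsElliptic] [E.IsCharNeTwoNF] [E₀.IsCharNeTwoNF]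
    (φ : Isogeny E E₀) (φ' : Isogeny E₀ E), smithCaseIV E → φ.IsBalanced →
    (∀ P, φ' (φ P) = (2 : ℤ) • P) →
    ∀ (d₀ d₁ : ℤ), d₀ ≠ 0 → smithTwistClass E d₀ d₁ →
      NoRationalFourTorsion (E.quadraticTwist (d₁ : ℚ)) →
      NoRationalFourTorsion (E₀.quadraticTwist (d₁ : ℚ)) →
    ∀ (r₂ rφ : ℕ), rφ ≤ r₂ →
      max ((φ.twistSelmerRank d₁ : ℤ) - φ'.twistSelmerRank d₁) 0 ≤ (rφ : ℤ) →
      Tendsto (fun H : ℕ ↦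
        (Nat.card {d : ℤ | smithTwistClass E d₀ d ∧ |d| ≤ (H : ℤ) ∧ φ.twistSelmerRank d = rφ ∧
            twistSelmerTorsionRank E d = r₂} : ℝ) /
          Nat.card {d : ℤ | smithTwistClass E d₀ d ∧ |d| ≤ (H : ℤ) ∧ φ.twistSelmerRank d = rφ})
        atTop (𝓝 (probKerDimAlt
          (((rφ : ℤ) - ((φ.twistSelmerRank d₁ : ℤ) - φ'.twistSelmerRank d₁)).toNat) (r₂ - rφ)))

/-- **Smith, arXiv:2503.17619, Theorem 1.14 (`2`-Selmer ranks, Case V).** "Choose an elliptic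
curve `E/ℚ` in Case V, choose distinct balanced isogenies `φ_1 : E → E_1`, `φ_2 : E → E_2`, and
choose a nonzero integer `d_0`. For `i = 1, 2`, take `u_i = u(φ_i, d_0)`, and take
`u_0 = −u_1 − u_2`. Then `u_0` is a nonnegative even integer. Further, given nonnegative integers
`r_2 ≥ r_{φ_1} ≥ max(0, u_1)`, we have
`lim_{H → ∞} #{d ∈ X_E(d_0, H) : r_{φ_1}(E^d) = r_{φ_1} and r_2(E^d) = r_2} / #{d ∈ X_E(d_0, H) : r_{φ_1}(E^d) = r_{φ_1}}
 = P^V(r_2 − r_{φ_1} | (r_{φ_1} − u_1) → u_0)`." Transcription as in `smith2025_thm110`/`112`: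
"distinct" = different kernels (as in `smithCaseV`); `φᵢ'` the duals; `u_i` read off ONE admissible
`d₁ ∈ X_E(d_0, ·)` with no rational `4`-torsion on `E^{d₁}, E_1^{d₁}, E_2^{d₁}`; "`u_0` is a
nonnegative even integer" = `∃ k : ℕ, u_0 = 2k`, and `P^V(j | n → u_0)` = `probKerDimV j n k`.
PREPRINT (arXiv only). [cite: SmithGoldfeld2025, Thm. 1.14 with Notation 1.8, 1.13] -/
def smith2025_thm114 : Prop :=
  ∀ (E E₁ E₂ : WeierstrassCurve ℚ) [E.IsElliptic] [E₁.IsElliptic] [E₂.IsElliptic]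
    [E.IsCharNeTwoNF] [E₁.IsCharNeTwoNF] [E₂.IsCharNeTwoNF]
    (φ₁ : Isogeny E E₁) (φ₁' : Isogeny E₁ E) (φ₂ : Isogeny E E₂) (φ₂' : Isogeny E₂ E),
    smithCaseV E → φ₁.IsBalanced → φ₂.IsBalanced →
    φ₁.toAddMonoidHom.ker ≠ φ₂.toAddMonoidHom.ker →
    (∀ P, φ₁' (φ₁ P) = (2 : ℤ) • P) → (∀ P, φ₂' (φ₂ P) = (2 : ℤ) • P) →
    ∀ (d₀ d₁ : ℤ), d₀ ≠ 0 → smithTwistClass E d₀ d₁ →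
      NoRationalFourTorsion (E.quadraticTwist (d₁ : ℚ)) →
      NoRationalFourTorsion (E₁.quadraticTwist (d₁ : ℚ)) →
      NoRationalFourTorsion (E₂.quadraticTwist (d₁ : ℚ)) →
    ∃ k : ℕ,
      -(((φ₁.twistSelmerRank d₁ : ℤ) - φ₁'.twistSelmerRank d₁) +
          ((φ₂.twistSelmerRank d₁ : ℤ) - φ₂'.twistSelmerRank d₁)) = 2 * (k : ℤ) ∧
      ∀ (r₂ rφ : ℕ), rφ ≤ r₂ →
        max 0 ((φ₁.twistSelmerRank d₁ : ℤ) - φ₁'.twistSelmerRank d₁) ≤ (rφ : ℤ) →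
        Tendsto (fun H : ℕ ↦
          (Nat.card {d : ℤ | smithTwistClass E d₀ d ∧ |d| ≤ (H : ℤ) ∧ φ₁.twistSelmerRank d = rφ ∧
              twistSelmerTorsionRank E d = r₂} : ℝ) /
            Nat.card {d : ℤ | smithTwistClass E d₀ d ∧ |d| ≤ (H : ℤ) ∧ φ₁.twistSelmerRank d = rφ})
          atTop (𝓝 (probKerDimV (r₂ - rφ)
            (((rφ : ℤ) - ((φ₁.twistSelmerRank d₁ : ℤ) - φ₁'.twistSelmerRank d₁)).toNat) k))

/-! ## Definitional API -/

/-- Unfolding `twistSelmerTorsionRank`: `r_2(E^d) = dim_{𝔽_2} Sel^{2^∞}(E^d)[2]`.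
[cite: SmithGoldfeld2025, Notation 1.8] -/
theorem twistSelmerTorsionRank_eq (W : WeierstrassCurve ℚ) (d : ℤ) :
    twistSelmerTorsionRank W d = selmerTorsionRank 2 (W.quadraticTwist (d : ℚ)) :=
  rfl

/-- A member of `X_E(d_0, H)` is squarefree (hence nonzero). [cite: SmithGoldfeld2025, Notation 1.8] -/
theorem smithTwistClass.squarefree {W : WeierstrassCurve ℚ} {d₀ d : ℤ}
    (h : smithTwistClass W d₀ d) : Squarefree d :=
  h.1

/-- A member of `X_E(d_0, H)` has `d d_0 > 0` (the condition at `v = ∞`). [cite: SmithGoldfeld2025, Notation 1.8] -/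
theorem smithTwistClass.pos {W : WeierstrassCurve ℚ} {d₀ d : ℤ}
    (h : smithTwistClass W d₀ d) : 0 < d₀ * d :=
  h.2.1

end Literature.NumberTheory.EllipticCurves

end
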